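import Summits.RiemannHypothesis.RiemannHypothesis.Theorems.UniversalFactorMediumUEval
import Mathlib.MeasureTheory.Integral.ExpDecay

/-!
# RiemannHypothesis / UniversalFactor — the y-cells of the one-sided averages (soundness, IV)

Route `RiemannHypothesis/UniversalFactor`, crux `MediumKernelNoGo` (stmt-RiemannHypothesis-2577), line
`one-sided-average-sign-test`.  Analytic facts about the side integrands
`g_σ(y) = Re H_0(x + σy) · e^{−ay}` (`σ = −1`: backward average `P`, `σ = +1`: forward average `Q`)
of the box checker `UniversalFactorMediumBoxDefs.lean`: `g_σ` extends to an entire function bounded by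
`5 e^{−a(Y_c − R_y)}` on the disc of radius `R_y ≤ 12` about the cell centre `Y_c` (strip bound
`‖H_0‖ ≤ 5` for `|Im| ≤ 12`, hypothesis `hH0` = registered `stub_H0cosh`), so `stub_quadH` bounds the
Gauss–Legendre error of every y-cell (`osaSide_cell_error`); `‖H_0(t)‖ ≤ H_0(0) = ∫₀^∞ Φ ≤ 1` on the
real axis gives the tail `|∫_Y^∞ g_σ| ≤ e^{−aY}/a` (`osaSide_tail`, registered sub-goal
`stub_osaSideTail`); `osaSide_decomp` cuts `∫₀^∞ g_σ` into cells + tail, and `osaSide_re_eq`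
identifies `∫ g_σ` with the real part of the crux's complex one-sided average.
-/

set_option linter.dupNamespace false

noncomputable section

namespace Summit.RiemannHypothesis.RiemannHypothesis.Theorems

open MeasureTheory Set
open Literature.NumberTheory.LFunctions
open Literature.Analysis.ValidatedNumerics Literature.Analysis.ValidatedNumerics.NumericsMP

/-! ## `H_0` on and near the real axis -/

/-- `H_0` is real on the real axis: `H_0(t) = Re H_0(t)` as complex numbers. [folklore] -/
theorem UniversalFactor.osa_deBruijnH_zero_ofReal (t : ℝ) :
    deBruijnH 0 (t : ℂ) = (((deBruijnH 0 (t : ℂ)).re : ℝ) : ℂ) := by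
  have h : deBruijnH 0 (t : ℂ) = ((∫ u in Ioi (0:ℝ), deBruijnPhi u * Real.cos (t * u) : ℝ) : ℂ) := by
    rw [deBruijnH_zero_eq_integral_cos]
    have e : (fun u : ℝ => ((deBruijnPhi u : ℝ) : ℂ) * Complex.cos ((t : ℂ) * u)) =
        fun u : ℝ => ((deBruijnPhi u * Real.cos (t * u) : ℝ) : ℂ) := by
      funext u; push_cast; ring
    rw [e, integral_complex_ofReal]
  rw [h, Complex.ofReal_re]

/-- Evenness on the real axis: `Re H_0(|t|) = Re H_0(t)`. [folklore] -/
theorem UniversalFactor.osa_re_deBruijnH_zero_abs (t : ℝ) :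
    (deBruijnH 0 ((|t| : ℝ) : ℂ)).re = (deBruijnH 0 (t : ℂ)).re := by
  rcases le_or_gt 0 t with h | h
  · rw [abs_of_nonneg h]
  · rw [abs_of_neg h, Complex.ofReal_neg, deBruijnH_neg]

/-- `t ↦ Re H_0(x + σ t)` is continuous. [folklore] -/
theorem UniversalFactor.osa_continuous_re_H0_affine (x σ : ℝ) :
    Continuous fun t : ℝ => (deBruijnH 0 (((x + σ * t : ℝ)) : ℂ)).re :=
  Complex.continuous_re.comp (((differentiable_deBruijnH_holds 0).continuous).comp (by fun_prop))

/-- **Disc bound**: `‖H_0(z)‖ ≤ 5` for `|Im z| ≤ 12` (from `stub_H0cosh`). [folklore] -/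
theorem UniversalFactor.norm_deBruijnH_zero_le_five
    (hH0 : (∀ z : ℂ, ‖deBruijnH 0 z‖ ≤ ∫ u in Ioi (0:ℝ), deBruijnPhi u * Real.cosh (z.im * u)) ∧
      IntegrableOn (fun u : ℝ => deBruijnPhi u * Real.cosh (12 * u)) (Ioi 0) ∧
      (∫ u in Ioi (0:ℝ), deBruijnPhi u * Real.cosh (12 * u)) ≤ 5)
    {z : ℂ} (hz : |z.im| ≤ 12) : ‖deBruijnH 0 z‖ ≤ 5 := by
  obtain ⟨h1, h2, h3⟩ := hH0
  refine (h1 z).trans (le_trans ?_ h3)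
  have hpt : ∀ u ∈ Ioi (0:ℝ), deBruijnPhi u * Real.cosh (z.im * u) ≤ deBruijnPhi u * Real.cosh (12 * u) := by
    intro u hu
    have hu0 : 0 ≤ u := le_of_lt hu
    refine mul_le_mul_of_nonneg_left ?_ (deBruijnPhi_pos_of_nonneg hu0).le
    rw [Real.cosh_le_cosh, abs_mul, abs_mul, abs_of_nonneg hu0, abs_of_pos (by norm_num : (0:ℝ) < 12)]
    exact mul_le_mul_of_nonneg_right hz hu0
  have hmeas : AEStronglyMeasurable (fun u : ℝ => deBruijnPhi u * Real.cosh (z.im * u)) (volume.restrict (Ioi 0)) := by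
    refine ContinuousOn.aestronglyMeasurable ?_ measurableSet_Ioi
    exact (continuousOn_deBruijnPhi_Ici.mono Ioi_subset_Ici_self).mul (by fun_prop : Continuous fun u : ℝ =>
      Real.cosh (z.im * u)).continuousOn
  have hint : IntegrableOn (fun u : ℝ => deBruijnPhi u * Real.cosh (z.im * u)) (Ioi 0) := by
    refine Integrable.mono' h2 hmeas ?_
    rw [ae_restrict_iff' measurableSet_Ioi]
    refine Filter.Eventually.of_forall fun u hu => ?_
    rw [Real.norm_eq_abs, abs_of_nonneg (mul_nonneg (deBruijnPhi_pos_of_nonneg (le_of_lt hu)).le (Real.cosh_pos _).le)]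
    exact hpt u hu
  exact setIntegral_mono_on hint h2 measurableSet_Ioi hpt

/-! ## The one-sided averages: integrand, cells, tails -/

/-- The complex side integrand `w ↦ H_0(x + σw) e^{−aw}` is entire. [folklore] -/
theorem UniversalFactor.osaSide_differentiable (x σ a : ℝ) :
    Differentiable ℂ fun w : ℂ => deBruijnH 0 ((x : ℂ) + (σ : ℂ) * w) * Complex.exp (-(a : ℂ) * w) := by
  refine Differentiable.mul ((differentiable_deBruijnH_holds 0).comp ?_) (by fun_prop)
  fun_prop

/-- On the real axis the side integrand is the real function `g(y) = Re H_0(x + σy) · e^{−ay}`. [folklore] -/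
theorem UniversalFactor.osaSide_ofReal (x σ a y : ℝ) :
    deBruijnH 0 ((x : ℂ) + (σ : ℂ) * (y : ℂ)) * Complex.exp (-(a : ℂ) * (y : ℂ)) =
      (((deBruijnH 0 (((x + σ * y : ℝ)) : ℂ)).re * Real.exp (-(a * y)) : ℝ) : ℂ) := by
  rw [show ((x : ℂ) + (σ : ℂ) * (y : ℂ)) = (((x + σ * y : ℝ)) : ℂ) by push_cast; ring,
    show (-(a : ℂ) * (y : ℂ)) = (((-(a * y) : ℝ)) : ℂ) by push_cast; ring, ← Complex.ofReal_exp]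
  conv_lhs => rw [UniversalFactor.osa_deBruijnH_zero_ofReal (x + σ * y)]
  push_cast; ring

/-- **Sphere bound for the side integrand**: on `‖z − Y_c‖ = R` (`R ≤ 12`, `|σ| ≤ 1`, `a ≥ 0`):
`‖H_0(x + σz) e^{−az}‖ ≤ 5 e^{−a(Y_c − R)}`. [folklore] -/
theorem UniversalFactor.osaSide_sphere_bound
    (hH0 : (∀ z : ℂ, ‖deBruijnH 0 z‖ ≤ ∫ u in Ioi (0:ℝ), deBruijnPhi u * Real.cosh (z.im * u)) ∧
      IntegrableOn (fun u : ℝ => deBruijnPhi u * Real.cosh (12 * u)) (Ioi 0) ∧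
      (∫ u in Ioi (0:ℝ), deBruijnPhi u * Real.cosh (12 * u)) ≤ 5)
    {x σ a Yc R : ℝ} (hσ : |σ| ≤ 1) (ha : 0 ≤ a) (hR : R ≤ 12) {z : ℂ} (hz : z ∈ Metric.sphere ((Yc : ℝ) : ℂ) R) :
    ‖deBruijnH 0 ((x : ℂ) + (σ : ℂ) * z) * Complex.exp (-(a : ℂ) * z)‖ ≤ 5 * Real.exp (-(a * (Yc - R))) := by
  rw [Metric.mem_sphere, dist_eq_norm] at hz
  have him : |z.im| ≤ R := by
    have := Complex.abs_im_le_norm (z - Yc); simp at this; rw [← hz]; exact this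
  have hre : Yc - R ≤ z.re := by
    have := Complex.abs_re_le_norm (z - Yc); simp at this; rw [hz] at this
    have := (abs_le.1 this).1; linarith
  rw [norm_mul, Complex.norm_exp]
  refine mul_le_mul ?_ ?_ (by positivity) (by norm_num)
  · refine UniversalFactor.norm_deBruijnH_zero_le_five hH0 ?_
    have : ((x : ℂ) + (σ : ℂ) * z).im = σ * z.im := by simp
    rw [this, abs_mul]
    calc |σ| * |z.im| ≤ 1 * 12 := mul_le_mul hσ (him.trans hR) (abs_nonneg _) (by norm_num)
      _ = 12 := one_mul _
  · apply Real.exp_le_exp.2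
    have : (-(a : ℂ) * z).re = -(a * z.re) := by simp
    rw [this]
    nlinarith

/-- The node sum of y-cell `c` of a side: `Σ_j ρW_j · Re H_0(x + σ y_{cj}) · e^{−a y_{cj}}`. [folklore] -/
theorem UniversalFactor.osaSide_gl_error
    (hH0 : (∀ z : ℂ, ‖deBruijnH 0 z‖ ≤ ∫ u in Ioi (0:ℝ), deBruijnPhi u * Real.cosh (z.im * u)) ∧
      IntegrableOn (fun u : ℝ => deBruijnPhi u * Real.cosh (12 * u)) (Ioi 0) ∧
      (∫ u in Ioi (0:ℝ), deBruijnPhi u * Real.cosh (12 * u)) ≤ 5)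
    {x σ a ρ R : ℝ} (hσ : |σ| ≤ 1) (ha : 0 ≤ a) (hρ : 0 ≤ ρ) (hρR : ρ < R) (hR : R ≤ 12) (c : ℕ) :
    |(∫ s in (-ρ)..ρ, (deBruijnH 0 (((x + σ * ((2 * c + 1) * ρ + s) : ℝ)) : ℂ)).re *
          Real.exp (-(a * ((2 * c + 1) * ρ + s)))) -
        ∑ j ∈ Finset.range 32, ρ * UniversalFactor.osaWeightR j *
          ((deBruijnH 0 (((x + σ * ((2 * c + 1) * ρ + ρ * UniversalFactor.osaNodeR j) : ℝ)) : ℂ)).re *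
            Real.exp (-(a * ((2 * c + 1) * ρ + ρ * UniversalFactor.osaNodeR j))))| ≤
      5 * Real.exp (-(a * ((2 * c + 1) * ρ - R))) * UniversalFactor.osaDefectR ρ R := by
  set Yc : ℝ := (2 * c + 1) * ρ with hYc
  set f : ℂ → ℂ := fun w => deBruijnH 0 ((x : ℂ) + (σ : ℂ) * w) * Complex.exp (-(a : ℂ) * w) with hf
  have hfd : DifferentiableOn ℂ f (Metric.ball ((Yc : ℝ) : ℂ) (R + 1)) :=
    (UniversalFactor.osaSide_differentiable x σ a).differentiableOn
  have hM : ∀ z ∈ Metric.sphere ((Yc : ℝ) : ℂ) R, ‖f z‖ ≤ 5 * Real.exp (-(a * (Yc - R))) :=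
    fun z hz => UniversalFactor.osaSide_sphere_bound hH0 hσ ha hR hz
  have hu : ∀ j ∈ Finset.range 32, |ρ * UniversalFactor.osaNodeR j| ≤ ρ := by
    intro j hj
    rw [abs_mul, abs_of_nonneg hρ]
    have := UniversalFactor.abs_osaNodeR_le (Finset.mem_range.1 hj)
    nlinarith [abs_nonneg (UniversalFactor.osaNodeR j)]
  have hq := UniversalFactor.stub_quadH f ((Yc : ℝ) : ℂ) R (R + 1) ρ (5 * Real.exp (-(a * (Yc - R)))) hρ hρR
    (by linarith) hfd hM (Finset.range 32) (fun j => ρ * UniversalFactor.osaNodeR j)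
    (fun j => ρ * UniversalFactor.osaWeightR j) hu 63
  have hfreal : ∀ s : ℝ, f ((Yc : ℂ) + (s : ℂ)) =
      (((deBruijnH 0 (((x + σ * (Yc + s) : ℝ)) : ℂ)).re * Real.exp (-(a * (Yc + s))) : ℝ) : ℂ) := by
    intro s
    rw [hf]; dsimp only
    rw [show ((Yc : ℂ) + (s : ℂ)) = ((Yc + s : ℝ) : ℂ) by push_cast; rfl, UniversalFactor.osaSide_ofReal]
  have hint : (∫ s in (-ρ)..ρ, f ((Yc : ℂ) + (s : ℂ))) =
      ((∫ s in (-ρ)..ρ, (deBruijnH 0 (((x + σ * (Yc + s) : ℝ)) : ℂ)).re * Real.exp (-(a * (Yc + s))) : ℝ) : ℂ) := by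
    rw [← intervalIntegral.integral_ofReal]
    exact intervalIntegral.integral_congr fun s _ => hfreal s
  have hsum : ∑ j ∈ Finset.range 32, ((ρ * UniversalFactor.osaWeightR j : ℝ) : ℂ) *
      f ((Yc : ℂ) + ((ρ * UniversalFactor.osaNodeR j : ℝ) : ℂ)) =
      ((∑ j ∈ Finset.range 32, ρ * UniversalFactor.osaWeightR j *
          ((deBruijnH 0 (((x + σ * (Yc + ρ * UniversalFactor.osaNodeR j) : ℝ)) : ℂ)).re *
            Real.exp (-(a * (Yc + ρ * UniversalFactor.osaNodeR j)))) : ℝ) : ℂ) := by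
    push_cast
    refine Finset.sum_congr rfl fun j _ => ?_
    rw [show ((ρ : ℂ) * (UniversalFactor.osaNodeR j : ℂ)) = ((ρ * UniversalFactor.osaNodeR j : ℝ) : ℂ) by push_cast; rfl,
      hfreal]
    push_cast; ring
  rw [hint, hsum, ← Complex.ofReal_sub, Complex.norm_real, Real.norm_eq_abs] at hq
  refine hq.trans (le_of_eq ?_)
  unfold UniversalFactor.osaDefectR
  simp only [show (63 : ℕ) + 1 = 64 from rfl]

/-- The real side integrand `g(y) = Re H_0(x + σy) e^{−ay}` is continuous. [folklore] -/
theorem UniversalFactor.osaSide_continuous (x σ a : ℝ) :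
    Continuous fun y : ℝ => (deBruijnH 0 (((x + σ * y : ℝ)) : ℂ)).re * Real.exp (-(a * y)) :=
  (UniversalFactor.osa_continuous_re_H0_affine x σ).mul (by fun_prop)

/-- `∫₀^∞ Φ ≤ 1` (from `stub_phiIoiTail` at `U = 0`: `50 e^{−π}/(4π − 9) < 1`). [folklore] -/
theorem UniversalFactor.osa_integral_phi_le_one : (∫ u in Ioi (0:ℝ), deBruijnPhi u) ≤ 1 := by
  refine (UniversalFactor.stub_phiIoiTail 0 le_rfl).trans ?_
  have hπ : 3 < Real.pi := Real.pi_gt_three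
  have hπ4 : Real.pi ≤ 4 := Real.pi_le_four
  simp only [mul_zero, Real.exp_zero, mul_one, zero_sub]
  have he : Real.exp (-Real.pi) ≤ Real.exp (-3) := Real.exp_le_exp.2 (by linarith)
  have he3 : Real.exp (-3) < 1 / 20 := by
    rw [Real.exp_neg, inv_lt_comm₀ (Real.exp_pos _) (by norm_num)]
    have h1 : (2.7182818283 : ℝ) < Real.exp 1 := Real.exp_one_gt_d9
    have : Real.exp 3 = Real.exp 1 ^ 3 := by rw [← Real.exp_nat_mul]; norm_num
    rw [this, one_div, inv_inv]
    have h2 : (2.7182818283 : ℝ) ^ 3 < Real.exp 1 ^ 3 := by gcongr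
    have h3 : (20 : ℝ) < (2.7182818283 : ℝ) ^ 3 := by norm_num
    linarith
  have hden : 3 < 4 * Real.pi - 9 := by linarith
  rw [div_le_one (by linarith)]
  nlinarith
/-- `‖H_0(t)‖ ≤ 1` on the real axis. [folklore] -/
theorem UniversalFactor.osa_norm_deBruijnH_zero_le_one (t : ℝ) : ‖deBruijnH 0 (t : ℂ)‖ ≤ 1 := by
  refine (UniversalFactor.norm_deBruijnH_zero_ofReal_le t).trans ?_
  rw [UniversalFactor.deBruijnH_zero_apply_zero, Complex.ofReal_re]
  exact UniversalFactor.osa_integral_phi_le_one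

/-- `|g(y)| ≤ e^{−ay}`. [folklore] -/
theorem UniversalFactor.osaSide_abs_le (x σ a y : ℝ) :
    |(deBruijnH 0 (((x + σ * y : ℝ)) : ℂ)).re * Real.exp (-(a * y))| ≤ Real.exp (-(a * y)) := by
  rw [abs_mul, abs_of_pos (Real.exp_pos _)]
  refine mul_le_of_le_one_left (Real.exp_pos _).le ?_
  exact (Complex.abs_re_le_norm _).trans (UniversalFactor.osa_norm_deBruijnH_zero_le_one _)

/-- The real side integrand is integrable on `(Y, ∞)` for `a > 0`. [folklore] -/
theorem UniversalFactor.osaSide_integrableOn {x σ a : ℝ} (ha : 0 < a) (Y : ℝ) :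
    IntegrableOn (fun y : ℝ => (deBruijnH 0 (((x + σ * y : ℝ)) : ℂ)).re * Real.exp (-(a * y))) (Ioi Y) := by
  have hg : IntegrableOn (fun y : ℝ => Real.exp (-a * y)) (Ioi Y) := exp_neg_integrableOn_Ioi Y ha
  refine Integrable.mono' hg (UniversalFactor.osaSide_continuous x σ a).aestronglyMeasurable ?_
  refine Filter.Eventually.of_forall fun y => ?_
  rw [Real.norm_eq_abs, show -a * y = -(a * y) by ring]
  exact UniversalFactor.osaSide_abs_le x σ a y

/-- **The tail of a side**: `|∫_Y^∞ g| ≤ e^{−aY}/a` for `a > 0`. [folklore] -/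
theorem UniversalFactor.osaSide_tail {x σ a : ℝ} (ha : 0 < a) (Y : ℝ) :
    |∫ y in Ioi Y, (deBruijnH 0 (((x + σ * y : ℝ)) : ℂ)).re * Real.exp (-(a * y))| ≤
      Real.exp (-(a * Y)) / a := by
  have hg : IntegrableOn (fun y : ℝ => Real.exp (-a * y)) (Ioi Y) := exp_neg_integrableOn_Ioi Y ha
  have h := norm_integral_le_of_norm_le hg (f := fun y : ℝ => (deBruijnH 0 (((x + σ * y : ℝ)) : ℂ)).re *
      Real.exp (-(a * y))) (μ := volume.restrict (Ioi Y))
    (Filter.Eventually.of_forall fun y => by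
      rw [Real.norm_eq_abs, show -a * y = -(a * y) by ring]; exact UniversalFactor.osaSide_abs_le x σ a y)
  rw [Real.norm_eq_abs] at h
  refine h.trans (le_of_eq ?_)
  rw [integral_exp_mul_Ioi (by linarith : -a < 0) Y]
  field_simp

/-- **The decomposition of a side**: `∫₀^∞ g = Σ_{c<Cy} ∫_{cell c} g + ∫_{2Cyρ}^∞ g`. [folklore] -/
theorem UniversalFactor.osaSide_decomp {x σ a : ℝ} (ha : 0 < a) (ρ : ℝ) (Cy : ℕ) :
    (∫ y in Ioi (0:ℝ), (deBruijnH 0 (((x + σ * y : ℝ)) : ℂ)).re * Real.exp (-(a * y))) =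
      ∑ c ∈ Finset.range Cy, (∫ y in (2 * c * ρ)..(2 * (c + 1) * ρ),
          (deBruijnH 0 (((x + σ * y : ℝ)) : ℂ)).re * Real.exp (-(a * y))) +
        ∫ y in Ioi (2 * Cy * ρ), (deBruijnH 0 (((x + σ * y : ℝ)) : ℂ)).re * Real.exp (-(a * y)) := by
  have hint := UniversalFactor.osaSide_integrableOn (x := x) (σ := σ) ha
  have hsum := intervalIntegral.sum_integral_adjacent_intervals
    (f := fun y : ℝ => (deBruijnH 0 (((x + σ * y : ℝ)) : ℂ)).re * Real.exp (-(a * y)))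
    (μ := volume) (a := fun k : ℕ => 2 * (k : ℝ) * ρ) (n := Cy)
    (fun k _ => ((UniversalFactor.osaSide_continuous x σ a).intervalIntegrable _ _))
  simp only [Nat.cast_zero, mul_zero, zero_mul] at hsum
  have hsum' : ∑ c ∈ Finset.range Cy, (∫ y in (2 * c * ρ)..(2 * (c + 1) * ρ),
      (deBruijnH 0 (((x + σ * y : ℝ)) : ℂ)).re * Real.exp (-(a * y))) =
      ∫ y in (0:ℝ)..(2 * Cy * ρ), (deBruijnH 0 (((x + σ * y : ℝ)) : ℂ)).re * Real.exp (-(a * y)) := by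
    rw [← hsum]
    refine Finset.sum_congr rfl fun c _ => ?_
    push_cast; rfl
  rw [hsum', intervalIntegral.integral_interval_add_Ioi (hint 0) (hint _)]

/-- **Total error on one y-cell**: `|∫_{2cρ}^{2(c+1)ρ} g − GL_c| ≤ 5 e^{−a(Y_c − R)} D(ρ,R)`. [folklore] -/
theorem UniversalFactor.osaSide_cell_error
    (hH0 : (∀ z : ℂ, ‖deBruijnH 0 z‖ ≤ ∫ u in Ioi (0:ℝ), deBruijnPhi u * Real.cosh (z.im * u)) ∧
      IntegrableOn (fun u : ℝ => deBruijnPhi u * Real.cosh (12 * u)) (Ioi 0) ∧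
      (∫ u in Ioi (0:ℝ), deBruijnPhi u * Real.cosh (12 * u)) ≤ 5)
    {x σ a ρ R : ℝ} (hσ : |σ| ≤ 1) (ha : 0 ≤ a) (hρ : 0 ≤ ρ) (hρR : ρ < R) (hR : R ≤ 12) (c : ℕ) :
    |(∫ y in (2 * c * ρ)..(2 * (c + 1) * ρ), (deBruijnH 0 (((x + σ * y : ℝ)) : ℂ)).re * Real.exp (-(a * y))) -
        ∑ j ∈ Finset.range 32, ρ * UniversalFactor.osaWeightR j *
          ((deBruijnH 0 (((x + σ * ((2 * c + 1) * ρ + ρ * UniversalFactor.osaNodeR j) : ℝ)) : ℂ)).re *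
            Real.exp (-(a * ((2 * c + 1) * ρ + ρ * UniversalFactor.osaNodeR j))))| ≤
      5 * Real.exp (-(a * ((2 * c + 1) * ρ - R))) * UniversalFactor.osaDefectR ρ R := by
  have hshift : (∫ y in (2 * c * ρ)..(2 * (c + 1) * ρ),
      (deBruijnH 0 (((x + σ * y : ℝ)) : ℂ)).re * Real.exp (-(a * y))) =
      ∫ s in (-ρ)..ρ, (deBruijnH 0 (((x + σ * ((2 * c + 1) * ρ + s) : ℝ)) : ℂ)).re *
        Real.exp (-(a * ((2 * c + 1) * ρ + s))) := by
    have h := intervalIntegral.integral_comp_add_left (a := -ρ) (b := ρ)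
      (fun y : ℝ => (deBruijnH 0 (((x + σ * y : ℝ)) : ℂ)).re * Real.exp (-(a * y))) ((2 * c + 1) * ρ)
    rw [h]; congr 1 <;> ring
  rw [hshift]
  exact UniversalFactor.osaSide_gl_error hH0 hσ ha hρ hρR hR c

/-- **The one-sided averages of the crux are the real side integrals** (`σ = −1`: `P_a`, `σ = 1`: `Q_a`). [folklore] -/
theorem UniversalFactor.osaSide_re_eq (x σ a : ℝ) :
    (∫ y in Ioi (0:ℝ), deBruijnH 0 ((x : ℂ) + (σ : ℂ) * (y : ℂ)) * (Real.exp (-(a * y)) : ℂ)).re =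
      ∫ y in Ioi (0:ℝ), (deBruijnH 0 (((x + σ * y : ℝ)) : ℂ)).re * Real.exp (-(a * y)) := by
  have e : (fun y : ℝ => deBruijnH 0 ((x : ℂ) + (σ : ℂ) * (y : ℂ)) * (Real.exp (-(a * y)) : ℂ)) =
      fun y : ℝ => (((deBruijnH 0 (((x + σ * y : ℝ)) : ℂ)).re * Real.exp (-(a * y)) : ℝ) : ℂ) := by
    funext y
    rw [← UniversalFactor.osaSide_ofReal]
    push_cast; ring_nf
  rw [e, integral_complex_ofReal, Complex.ofReal_re]

/-- **Registered sub-goal `stub_osaSideTail`** (the y-tail of a one-sided average). [folklore] -/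
theorem UniversalFactor.stub_osaSideTail :
    ∀ (x σ a : ℝ), 0 < a → ∀ (Y : ℝ),
      |∫ y in Set.Ioi Y, (deBruijnH 0 (((x + σ * y : ℝ)) : ℂ)).re * Real.exp (-(a * y))| ≤ Real.exp (-(a * Y)) / a :=
  fun _ _ _ ha Y => UniversalFactor.osaSide_tail ha Y

end Summit.RiemannHypothesis.RiemannHypothesis.Theorems
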